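import Mathlib.Data.Nat.Factors
import Mathlib.Data.Nat.PrimeFin
import Mathlib.Analysis.SpecialFunctions.Pow.Real
import Mathlib.Algebra.Order.Floor.Semiring
import HarnessLib

/-!
# Smooth numbers with restricted prime factors: the counting functions of LP92 §6

H. W. Lenstra Jr. and C. Pomerance, *A rigorous time bound for factoring integers*,
J. Amer. Math. Soc. **5** (1992) 483–516, §6 (p. 499): for positive reals `v, x, y` and a set of
primes `𝓟`,

* `ψ(x, y; 𝓟)` = the number of positive integers `≤ x` all of whose prime factors are `≤ y` and
  belong to `𝓟` — here `smoothCountIn 𝓟 x y = #(smoothSetIn 𝓟 x y)`;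
* `π(x; 𝓟) = #{p ∈ 𝓟 : p ≤ x}` — here `primeCountIn 𝓟 x = #(primesBelowIn 𝓟 x)`;
* `S(v, y; 𝓟) = ∑_{p ∈ 𝓟, v < p ≤ y} 1/p` — here `primeRecipSumIn 𝓟 v y`, the sum over
  `primesBetweenIn 𝓟 v y`.

We allow an arbitrary `𝓟 : Set ℕ` and intersect with the primes in `π` and `S` (for a set of
primes, as in the paper, this changes nothing). In addition, `kProducts Q k` is the finite set of
products of `k` (not necessarily distinct) elements of a finite set `Q` — the set `𝓜` of products
of `[u]` primes `p ∈ 𝓟`, `v < p ≤ y`, in the proof of Theorem 6.1 (p. 499).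

This file only sets up the objects and their membership lemmas; the counting inequalities of the
proof of Theorem 6.1 are in `LenstraPomeranceKProducts`, the theorem itself in
`LenstraPomeranceThm61`. Mathlib's `Nat.smoothNumbers` / `Nat.smoothNumbersUpTo` count
`y`-smooth numbers without the restriction to a set of primes `𝓟`, which is the point here, so
they are not used.
-/

namespace Literature.NumberTheory.Sieve
namespace LenstraPomerance

open Finset

/-! ### Products of `k` elements of a finite set -/

/-- `kProducts Q k` is the finite set of natural numbers of the form `q₁ ⋯ qₖ` with every
`qᵢ ∈ Q` (repetitions allowed); `kProducts Q 0 = {1}` and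
`kProducts Q (k+1) = {q · m | q ∈ Q, m ∈ kProducts Q k}`. For `Q` the set of primes of `𝓟` in
`(v, y]` and `k = [u]` this is the set `𝓜` in the proof of Theorem 6.1 of Lenstra–Pomerance.
[cite: LenstraPomerance1992, §6 (proof of Theorem 6.1, p. 499)] -/
def kProducts (Q : Finset ℕ) : ℕ → Finset ℕ
  | 0 => {1}
  | k + 1 => (Q ×ˢ kProducts Q k).image fun x => x.1 * x.2

/-- `kProducts Q 0 = {1}`. [cite: LenstraPomerance1992, §6 (proof of Theorem 6.1, p. 499)] -/
@[simp] theorem kProducts_zero (Q : Finset ℕ) : kProducts Q 0 = {1} := rfl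

/-- The defining recursion of `kProducts`. [cite: LenstraPomerance1992, §6 (proof of Theorem 6.1, p. 499)] -/
theorem kProducts_succ (Q : Finset ℕ) (k : ℕ) :
    kProducts Q (k + 1) = (Q ×ˢ kProducts Q k).image fun x => x.1 * x.2 := rfl

/-- Membership in `kProducts Q k`: `m` is the product of a list of length `k` of elements of `Q`.
[cite: LenstraPomerance1992, §6 (proof of Theorem 6.1, p. 499)] -/
theorem mem_kProducts_iff {Q : Finset ℕ} {k m : ℕ} :
    m ∈ kProducts Q k ↔ ∃ l : List ℕ, (∀ p ∈ l, p ∈ Q) ∧ l.length = k ∧ l.prod = m := by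
  induction k generalizing m with
  | zero =>
    simp only [kProducts_zero, mem_singleton]
    constructor
    · rintro rfl
      exact ⟨[], by simp, rfl, rfl⟩
    · rintro ⟨l, -, hl, rfl⟩
      rw [List.length_eq_zero_iff] at hl
      simp [hl]
  | succ k ih =>
    simp only [kProducts_succ, mem_image, mem_product, Prod.exists]
    constructor
    · rintro ⟨p, m', ⟨hp, hm'⟩, rfl⟩
      obtain ⟨l, hlQ, hlk, rfl⟩ := ih.1 hm'
      refine ⟨p :: l, ?_, by simp [hlk], by simp⟩
      intro q hq
      rcases List.mem_cons.1 hq with rfl | hq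
      · exact hp
      · exact hlQ q hq
    · rintro ⟨l, hlQ, hlk, rfl⟩
      match l, hlQ, hlk with
      | p :: l', hlQ', hlk' =>
        simp only [List.length_cons, Nat.add_right_cancel_iff] at hlk'
        exact ⟨p, l'.prod, ⟨hlQ' p (by simp),
          ih.2 ⟨l', fun q hq => hlQ' q (by simp [hq]), hlk', rfl⟩⟩, by simp⟩

/-! ### The counting functions -/

open Classical in
/-- The finite set of positive integers `n ≤ x` all of whose prime factors are `≤ y` and lie in
`P` (so `ψ(x, y; P) = #(smoothSetIn P x y)`; `n = 1` is always counted when `x ≥ 1`).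
[cite: LenstraPomerance1992, §6 (p. 499)] -/
noncomputable def smoothSetIn (P : Set ℕ) (x y : ℝ) : Finset ℕ :=
  {n ∈ Finset.Icc 1 ⌊x⌋₊ | ∀ p ∈ n.primeFactors, (p : ℝ) ≤ y ∧ p ∈ P}

/-- `ψ(x, y; P)`: the number of positive integers `≤ x` all of whose prime factors are `≤ y` and
belong to `P`. [cite: LenstraPomerance1992, §6 (p. 499)] -/
noncomputable def smoothCountIn (P : Set ℕ) (x y : ℝ) : ℕ := #(smoothSetIn P x y)

open Classical in
/-- The finite set of primes `p ≤ x` with `p ∈ P`. [cite: LenstraPomerance1992, §6 (p. 499)] -/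
noncomputable def primesBelowIn (P : Set ℕ) (x : ℝ) : Finset ℕ :=
  {p ∈ Finset.Iic ⌊x⌋₊ | p.Prime ∧ p ∈ P}

/-- `π(x; P) = #{p ∈ P prime : p ≤ x}`. [cite: LenstraPomerance1992, §6 (p. 499)] -/
noncomputable def primeCountIn (P : Set ℕ) (x : ℝ) : ℕ := #(primesBelowIn P x)

open Classical in
/-- The finite set of primes `p ∈ P` with `v < p ≤ y`. [cite: LenstraPomerance1992, §6 (p. 499)] -/
noncomputable def primesBetweenIn (P : Set ℕ) (v y : ℝ) : Finset ℕ :=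
  {p ∈ primesBelowIn P y | v < (p : ℝ)}

/-- `S(v, y; P) = ∑_{p ∈ P prime, v < p ≤ y} 1/p`. [cite: LenstraPomerance1992, §6 (p. 499)] -/
noncomputable def primeRecipSumIn (P : Set ℕ) (v y : ℝ) : ℝ :=
  ∑ p ∈ primesBetweenIn P v y, (1 : ℝ) / p

/-- Membership in `smoothSetIn`. [cite: LenstraPomerance1992, §6 (p. 499)] -/
theorem mem_smoothSetIn {P : Set ℕ} {x y : ℝ} {n : ℕ} :
    n ∈ smoothSetIn P x y ↔
      1 ≤ n ∧ (n : ℝ) ≤ x ∧ ∀ p ∈ n.primeFactors, (p : ℝ) ≤ y ∧ p ∈ P := by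
  classical
  unfold smoothSetIn
  rw [mem_filter, mem_Icc]
  constructor
  · rintro ⟨⟨h1, hx⟩, hp⟩
    exact ⟨h1, (Nat.le_floor_iff' (by omega)).1 hx, hp⟩
  · rintro ⟨h1, hx, hp⟩
    exact ⟨⟨h1, (Nat.le_floor_iff' (by omega)).2 hx⟩, hp⟩

/-- Membership in `primesBelowIn`. [cite: LenstraPomerance1992, §6 (p. 499)] -/
theorem mem_primesBelowIn {P : Set ℕ} {x : ℝ} {p : ℕ} :
    p ∈ primesBelowIn P x ↔ p.Prime ∧ p ∈ P ∧ (p : ℝ) ≤ x := by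
  classical
  unfold primesBelowIn
  rw [mem_filter, mem_Iic]
  constructor
  · rintro ⟨hx, hp, hP⟩
    exact ⟨hp, hP, (Nat.le_floor_iff' hp.ne_zero).1 hx⟩
  · rintro ⟨hp, hP, hx⟩
    exact ⟨(Nat.le_floor_iff' hp.ne_zero).2 hx, hp, hP⟩

/-- Membership in `primesBetweenIn`. [cite: LenstraPomerance1992, §6 (p. 499)] -/
theorem mem_primesBetweenIn {P : Set ℕ} {v y : ℝ} {p : ℕ} :
    p ∈ primesBetweenIn P v y ↔ p.Prime ∧ p ∈ P ∧ v < (p : ℝ) ∧ (p : ℝ) ≤ y := by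
  classical
  unfold primesBetweenIn
  rw [mem_filter, mem_primesBelowIn]
  tauto

/-- `1` is counted by `ψ(x, y; P)` as soon as `x ≥ 1`. [cite: LenstraPomerance1992, §6 (p. 500)] -/
theorem one_le_smoothCountIn {P : Set ℕ} {x : ℝ} (hx : 1 ≤ x) (y : ℝ) :
    1 ≤ smoothCountIn P x y := by
  unfold smoothCountIn
  rw [Nat.one_le_iff_ne_zero, Ne, card_eq_zero, ← Ne, ← nonempty_iff_ne_empty]
  exact ⟨1, mem_smoothSetIn.2 ⟨le_rfl, by simpa using hx, by simp⟩⟩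

/-- `π(x; P) ≤ ⌊x⌋`. [folklore] -/
theorem primeCountIn_le_floor (P : Set ℕ) (x : ℝ) : primeCountIn P x ≤ ⌊x⌋₊ := by
  classical
  unfold primeCountIn
  have hsub : primesBelowIn P x ⊆ (Finset.Iic ⌊x⌋₊).erase 0 := by
    intro p hp
    have hp' := mem_primesBelowIn.1 hp
    rw [mem_erase, mem_Iic]
    refine ⟨hp'.1.ne_zero, ?_⟩
    unfold primesBelowIn at hp
    exact mem_Iic.1 (mem_filter.1 hp).1
  calc #(primesBelowIn P x) ≤ #((Finset.Iic ⌊x⌋₊).erase 0) := card_le_card hsub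
    _ = ⌊x⌋₊ := by rw [card_erase_of_mem (by simp), Nat.card_Iic]; omega

/-- `π(x; P) ≤ x` for `x ≥ 0`. [folklore] -/
theorem primeCountIn_le_self (P : Set ℕ) {x : ℝ} (hx : 0 ≤ x) :
    (primeCountIn P x : ℝ) ≤ x :=
  (Nat.cast_le.2 (primeCountIn_le_floor P x)).trans (Nat.floor_le hx)

/-- `S(v, y; P) ≥ 0`. [folklore] -/
theorem primeRecipSumIn_nonneg (P : Set ℕ) (v y : ℝ) : 0 ≤ primeRecipSumIn P v y :=
  sum_nonneg fun p _ => by positivity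

end LenstraPomerance
end Literature.NumberTheory.Sieve
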